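import Literature.NumberTheory.PAdicHodge.UnramifiedWittPeriodMatrix
import HarnessLib

/-!
# An arithmetic Frobenius acts on `W(k̄)` as `φ^f`: the crystalline Frobenius of the period matrix

Continuation of `UnramifiedWittPeriodMatrix`.  Let `σ₀ ∈ Γ_F` be an arithmetic Frobenius
(`IsAbsArithFrob`: it acts on `k̄` as `y ↦ y^{q_F}`) and `q_F = p ^ f`.  Then

* `IsAbsArithFrob.wittGal_eq_iterate_frobenius` — **`𝕎(σ̄₀) = φ^f` on `W(k̄)`** (`φ` the Witt-vector
  Frobenius, Mathlib `WittVector.frobenius`), and `𝕎(σ̄₀^a) = φ^{fa}`;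
* `IsAbsArithFrob.iterate_frobenius_periodMatrix` — **the crystalline Frobenius of an unramified
  representation**: if `X = R(σ₀) · 𝕎(σ̄₀)(X)` (the Frobenius relation of the period matrix of
  `r : Γ_F →ₜ* GL_N(ℤ_p)`, `exists_isUnit_forall_eq_mul_wittGal`) and `V · R(σ₀) = 1`, then
  `φ^{fa}(X) = V^a · X = R(σ₀)^{-a} · X` entrywise: on the `φ`-module
  `D_cris(V) ⊆ W(k̄)[1/p] ⊗_{ℚ_p} V` spanned by the columns of `X`, the LINEAR Frobenius `φ^f` acts
  through `r(σ₀)⁻¹`, the geometric Frobenius — the normalisation by which Fontaine's recipe gives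
  `WD(D_cris(ρ)) = (ρ|_{W_F}, N = 0)` for unramified `ρ` (clause (F8) of `IsFontaineDatum`;
  Fontaine 1994, Exp. III §5 and Exp. VIII §1.3).

No definitions, no named facts.

## References
* [FontaineAsterisque223III] J.-M. Fontaine, Astérisque 223 (1994), Exp. III §5.
* [SerreLocalFields1979] J.-P. Serre, *Local Fields*, GTM 67, Ch. II §6 (Witt vectors, Frobenius).
-/

noncomputable section

open WittVector IsLocalRing Matrix Field ValuativeRel
open scoped ValuativeRel MatrixGroups

namespace Literature.NumberTheory.PAdicHodge

open Literature.NumberTheory.GaloisRepresentations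
open Literature.NumberTheory.GaloisRepresentations.IsNonarchimedeanLocalField

variable {F : Type} [Field F] [ValuativeRel F] [TopologicalSpace F] [IsNonarchimedeanLocalField F]
  {p : ℕ} [Fact p.Prime] [CharP (IsLocalRing.ResidueField (maxUnramifiedCompletion F)) p] {N : ℕ}

/-- **`𝕎(σ̄₀) = φ^f` on `W(k̄)`**: for an arithmetic Frobenius `σ₀` (acting on `k̄` as `y ↦ y^q`,
`IsAbsArithFrob.residueGal_eq_pow`) and `q_F = p ^ f`, the Galois action of `σ₀` on `W(k̄)` is the
`f`-th iterate of the Witt-vector Frobenius `φ` (Mathlib `WittVector.frobenius_eq_map_frobenius`).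
[cite: FontaineAsterisque223III, Exp. III §5] -/
theorem IsAbsArithFrob.wittGal_eq_iterate_frobenius {σ₀ : absoluteGaloisGroup F} (hσ₀ : IsAbsArithFrob σ₀)
    {f : ℕ} (hq : residueFieldCard F = p ^ f) (x : WittVector p (IsLocalRing.ResidueField (maxUnramifiedCompletion F))) :
    wittGal σ₀ x =
      (⇑(WittVector.frobenius : WittVector p (IsLocalRing.ResidueField (maxUnramifiedCompletion F)) →+*
        WittVector p (IsLocalRing.ResidueField (maxUnramifiedCompletion F))))^[f] x := by
  rw [WittVector.frobenius_eq_map_frobenius]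
  refine WittVector.ext fun n => ?_
  rw [coeff_wittGal, IsAbsArithFrob.residueGal_eq_pow hσ₀, hq, ← iterate_frobenius]
  clear hq
  induction f generalizing x with
  | zero => rfl
  | succ f ih =>
    rw [Function.iterate_succ_apply, Function.iterate_succ_apply, ← WittVector.map_coeff, ih]

/-- `𝕎(σ̄₀ ^ a) = φ^{f a}` on `W(k̄)`. [folklore] -/
theorem IsAbsArithFrob.wittGal_pow_eq_iterate_frobenius {σ₀ : absoluteGaloisGroup F} (hσ₀ : IsAbsArithFrob σ₀)
    {f : ℕ} (hq : residueFieldCard F = p ^ f) (a : ℕ) (x : WittVector p (IsLocalRing.ResidueField (maxUnramifiedCompletion F))) :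
    wittGal (σ₀ ^ a) x =
      (⇑(WittVector.frobenius : WittVector p (IsLocalRing.ResidueField (maxUnramifiedCompletion F)) →+*
        WittVector p (IsLocalRing.ResidueField (maxUnramifiedCompletion F))))^[f * a] x := by
  induction a generalizing x with
  | zero => rw [pow_zero, wittGal_one, mul_zero, Function.iterate_zero_apply]
  | succ a ih =>
    rw [pow_succ, wittGal_mul, IsAbsArithFrob.wittGal_eq_iterate_frobenius hσ₀ hq, ih, ← Function.iterate_add_apply,
      mul_add, mul_one]

/-- **The crystalline Frobenius of an unramified representation.** If `X = R(σ₀) · 𝕎(σ̄₀)(X)` (the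
Frobenius relation of the period matrix of `r`, `exists_isUnit_forall_eq_mul_wittGal`) for an
arithmetic Frobenius `σ₀`, `q_F = p ^ f`, and `V · R(σ₀) = 1`, then entrywise
`φ^{f a}(X) = V ^ a · X = R(σ₀)^{-a} · X` for all `a`: on the `φ`-module `D_cris(V)` spanned by the
columns of `X`, the linear Frobenius `φ^f` acts through `r(σ₀)⁻¹`, the GEOMETRIC Frobenius — the
normalisation by which `WD(D_cris(ρ)) = (ρ|_{W_F}, N = 0)` for unramified `ρ` (clause (F8) of
`IsFontaineDatum`; Fontaine 1994, Exp. III §5, Exp. VIII §1.3). [cite: FontaineAsterisque223III, Exp. III §5] -/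
theorem IsAbsArithFrob.iterate_frobenius_periodMatrix (r : absoluteGaloisGroup F →ₜ* GL (Fin N) ℤ_[p])
    {σ₀ : absoluteGaloisGroup F} (hσ₀ : IsAbsArithFrob σ₀) {f : ℕ} (hq : residueFieldCard F = p ^ f)
    {X V : Matrix (Fin N) (Fin N) (WittVector p (IsLocalRing.ResidueField (maxUnramifiedCompletion F)))}
    (hVR : V * wittPeriodCoeff (p := p) r σ₀ = 1)
    (hX : X = wittPeriodCoeff (p := p) r σ₀ * wittGalMatrix σ₀ X) (a : ℕ) (i j : Fin N) :
    (⇑(WittVector.frobenius : WittVector p (IsLocalRing.ResidueField (maxUnramifiedCompletion F)) →+*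
        WittVector p (IsLocalRing.ResidueField (maxUnramifiedCompletion F))))^[f * a] (X i j) = (V ^ a * X) i j := by
  rw [← IsAbsArithFrob.wittGal_pow_eq_iterate_frobenius hσ₀ hq a, ← wittGalMatrix_apply,
    map_pow_eq_pow_mul_of_eq_mul_map (A := WittVector p (IsLocalRing.ResidueField (maxUnramifiedCompletion F)))
      (Γ := absoluteGaloisGroup F) (wittGalMatrix (F := F) (p := p) (N := N))
      (wittGalMatrix_one (F := F) (p := p) (N := N)) (wittGalMatrix_mul (F := F) (p := p) (N := N)) hVR
      (fun τ => wittGalMatrix_wittPeriodCoeff (p := p) r τ σ₀) hX a]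

end Literature.NumberTheory.PAdicHodge

end
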